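import Literature.Analysis.FluidPDE.NSSereginL3BlowupHolds
import Literature.Analysis.FluidPDE.NSCriticalClosureHolds
import Literature.Analysis.FluidPDE.NSCriticalClosureBesovKatoClass
import Summits.NavierStokesRegularity.NavierStokesRegularity.Theorems.CertifiedBlowupCertifiedBlowupAxisymBlowupSwirlPersists
import HarnessLib

/-!
# Witnesses of the crux `CertifiedBlowupAxisymBlowup`: the critical norm `‖u(t)‖_{L³}` blows up

Theorems file landed `--supports stmt-NavierStokesRegularity-0727`, line `compact-amplification`
(continuation lead c3, wave 1; registered stub `tendsto_eLpNorm_three_of_isMaximalSmoothSolution`).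
The crux asks for a viscosity `ν > 0`, a time `T > 0` and a maximal smooth solution `(u, p)` of
lifespan `T`, Leray–Hopf on `[0, T]` from its rapidly decaying axisymmetric datum `u 0`. This file
proves, for an ARBITRARY such witness `(ν, T, u, p)` and using only PROVED theorems of the tree:

* `tendsto_eLpNorm_three_of_isMaximalSmoothSolution` (registered): **Seregin's `L³` blow-up**
  `‖u(t)‖_{L³} → ∞` as `t ↑ T` (a genuine limit in `[0, ∞]`; Seregin 2012, Thm. 1.1, the tree's
  discharged `seregin_L3_blowup_holds`), **and** `sup_{0 ≤ t < T} ‖u(t)‖_{L³} = ∞`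
  (Escauriaza–Seregin–Šverák 2003, Thms. 1.3–1.4, by maximality against the tree's discharged
  continuation criterion `hasSmoothExtensionPast_of_eLpNorm_three_bounded_holds`). The two side
  hypotheses of `seregin_L3_blowup` are supplied from the crux's class: `u 0 ∈ L³` because the
  solution is a Kato `C([0,T); L³)` solution (`isKatoSolutionOn_of_classical`), and essential
  boundedness on every closed sub-strip `[0, T'] × ℝ³`, `0 < T' < T`, from the pointwise bound
  `bounded_before_of_lerayHopf_classical`;
* `not_memLqLp_top_three_of_isMaximalSmoothSolution`: the ESS corollary — no witness lies in the
  endpoint class `L^∞(0, T; L³(ℝ³))` (`MemLqLp ∞ 3 u (Ioo 0 T)` fails).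

This is the constraint every certification of the crux (and the `SwirlThreshold` zoom) must respect:
no witness stays bounded in the critical space `L³(ℝ³)` up to its singular time.

No new definitions, no named-fact hypotheses, no `sorry`.

## References

* G. Seregin, *A certain necessary condition of potential blow up for Navier–Stokes equations*,
  Comm. Math. Phys. 312 (2012), 833–845, Thm. 1.1. [Seregin2012] [Seregin2012CMP]
* L. Escauriaza, G. Seregin, V. Šverák, *`L_{3,∞}`-solutions of Navier–Stokes equations and backward
  uniqueness*, Russ. Math. Surveys 58 (2003), 211–250, Thms. 1.3–1.4. [EscauriazaSereginSverak2003]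
* P. G. Lemarié-Rieusset, *The Navier–Stokes Problem in the 21st Century*, CRC 2016, Thm. 15.5
  (p. 570). [LemarieRieusset2016]
-/

-- the summit and its single problem share the name (D-0017 nested layout)
set_option linter.dupNamespace false

noncomputable section

open MeasureTheory Set Function Filter Topology Metric
open scoped ENNReal NNReal

namespace Summit.NavierStokesRegularity.NavierStokesRegularity.Theorems.CertifiedBlowupAxisymBlowup.CompactAmplification

open Literature.Analysis.FluidPDE

section Witness

variable {ν T : ℝ} {u : ℝ → (EuclideanSpace ℝ (Fin 3)) → (EuclideanSpace ℝ (Fin 3))} {p : ℝ → (EuclideanSpace ℝ (Fin 3)) → ℝ}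

/-- **Essential boundedness on every closed sub-strip** `[0, T'] × ℝ³`, `0 < T' < T`, of a
classical Leray–Hopf solution on `[0, T)` from a rapidly decaying axisymmetric datum:
`‖u‖_{L^∞([0,T'] × ℝ³)} < ∞` — the hypothesis `hbdd` of the tree's `seregin_L3_blowup`, from the
pointwise bound `bounded_before_of_lerayHopf_classical`. [folklore] -/
private theorem l3_eLpNorm_uncurry_lt_top (hν : 0 < ν)
    (hcl : IsClassicalNSSolutionOn (Ico 0 T) ν 0 u p) (hLH : IsLerayHopfOn T ν 0 (u 0) u)
    (hdec : HasRapidSpatialDecay (u 0)) (haxi : IsAxisymmetric (u 0)) :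
    ∀ T' ∈ Ioo 0 T, eLpNorm (uncurry u) ∞ (volume.restrict (Icc 0 T' ×ˢ univ)) < ∞ := by
  intro T' hT'
  obtain ⟨M, hM⟩ := bounded_before_of_lerayHopf_classical hν hcl hLH hdec haxi T' hT'.2
  rw [eLpNorm_exponent_top]
  refine eLpNormEssSup_lt_top_of_ae_bound (C := M)
    (ae_restrict_of_forall_mem (measurableSet_Icc.prod MeasurableSet.univ) ?_)
  rintro ⟨t, x⟩ ⟨ht, -⟩
  exact hM t ht x

/-- **The datum of a classical Leray–Hopf solution on `[0, T)`, `0 < T`, from a rapidly decaying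
datum lies in `L³(ℝ³)`**: the solution is a Kato `C([0,T); L³)` solution
(`isKatoSolutionOn_of_classical`, Lemarié-Rieusset 2016 Thm. 15.1), whose slice at `t = 0` is an
`L³` field. [cite: LemarieRieusset2016, Thm. 15.1 (A)-(B)] -/
theorem memLp_three_datum_of_lerayHopf_classical (hν : 0 < ν) (hT : 0 < T)
    (hcl : IsClassicalNSSolutionOn (Ico 0 T) ν 0 u p) (hLH : IsLerayHopfOn T ν 0 (u 0) u)
    (hdec : HasRapidSpatialDecay (u 0)) : MemLp (u 0) 3 volume :=
  (isKatoSolutionOn_of_classical hν hT hcl hLH hdec).memLp ⟨le_rfl, hT⟩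

/-- **Seregin's `L³` blow-up for the crux's class** (Seregin 2012, Thm. 1.1 = the tree's
discharged `seregin_L3_blowup_holds`): along a maximal Leray–Hopf classical solution of finite
lifespan `T` from a rapidly decaying axisymmetric datum, `‖u(t)‖_{L³} → ∞` as `t ↑ T`.
[cite: Seregin2012, Comm. Math. Phys. 312 Thm. 1.1] -/
theorem tendsto_eLpNorm_three_nhdsLT_of_isMaximalSmoothSolution (hν : 0 < ν) (hT : 0 < T)
    (hmax : IsMaximalSmoothSolution ν 0 u p T) (hLH : IsLerayHopfOn T ν 0 (u 0) u)
    (hdec : HasRapidSpatialDecay (u 0)) (haxi : IsAxisymmetric (u 0)) :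
    Tendsto (fun t => eLpNorm (u t) 3 volume) (𝓝[<] T) (𝓝 ∞) :=
  seregin_L3_blowup_holds hν hT hmax hLH
    (memLp_three_datum_of_lerayHopf_classical hν hT hmax.1 hLH hdec)
    (l3_eLpNorm_uncurry_lt_top hν hmax.1 hLH hdec haxi)

/-- **No witness lies in the endpoint class `L^∞(0, T; L³(ℝ³))`** (Escauriaza–Seregin–Šverák 2003,
Thms. 1.3–1.4: Leray–Hopf solutions in `L^∞_t L³_x` are smooth and continue; here read off the
genuine limit `‖u(t)‖_{L³} → ∞`, which is incompatible with an essential bound of `t ↦ ‖u(t)‖_{L³}`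
on `(0, T)` since every left neighbourhood of `T` meets `(0, T)` in a set of positive measure and all
slices before `T` are `L³` fields). [cite: EscauriazaSereginSverak2003, Thms. 1.3–1.4] -/
theorem not_memLqLp_top_three_of_isMaximalSmoothSolution (hν : 0 < ν) (hT : 0 < T)
    (hmax : IsMaximalSmoothSolution ν 0 u p T) (hLH : IsLerayHopfOn T ν 0 (u 0) u)
    (hdec : HasRapidSpatialDecay (u 0)) (haxi : IsAxisymmetric (u 0)) :
    ¬ MemLqLp ∞ 3 u (Ioo 0 T) := by
  rintro ⟨-, hfin⟩
  rw [eLqLpNorm_def, eLpNorm_exponent_top] at hfin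
  have hK : IsKatoSolutionOn T ν (u 0) u := isKatoSolutionOn_of_classical hν hT hmax.1 hLH hdec
  -- a.e. on `(0, T)` the critical norm is at most the (finite) essential supremum
  have hae : ∀ᵐ t ∂(volume.restrict (Ioo 0 T)), eLpNorm (u t) 3 volume ≤
      eLpNormEssSup (fun t => (eLpNorm (u t) 3 volume).toReal) (volume.restrict (Ioo 0 T)) := by
    filter_upwards [enorm_ae_le_eLpNormEssSup (fun t => (eLpNorm (u t) 3 volume).toReal)
      (volume.restrict (Ioo 0 T)), ae_restrict_mem measurableSet_Ioo] with t ht htI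
    have h3 : eLpNorm (u t) 3 volume ≠ ⊤ := (hK.memLp ⟨htI.1.le, htI.2⟩).eLpNorm_ne_top
    calc eLpNorm (u t) 3 volume = ENNReal.ofReal (eLpNorm (u t) 3 volume).toReal :=
          (ENNReal.ofReal_toReal h3).symm
      _ = ‖(eLpNorm (u t) 3 volume).toReal‖ₑ := (Real.enorm_eq_ofReal ENNReal.toReal_nonneg).symm
      _ ≤ _ := ht
  -- while on some `(l, T)` it exceeds the essential supremum (Seregin's limit)
  obtain ⟨l, hl, hsub⟩ := mem_nhdsLT_iff_exists_Ioo_subset.1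
    ((tendsto_eLpNorm_three_nhdsLT_of_isMaximalSmoothSolution hν hT hmax hLH hdec haxi).eventually
      (eventually_gt_nhds hfin))
  -- `(max l 0, T)` has positive measure: contradiction
  haveI : (ae (volume.restrict (Ioo (max l 0) T))).NeBot := by
    rw [ae_neBot, Ne, Measure.restrict_eq_zero, Real.volume_Ioo, ENNReal.ofReal_eq_zero, not_le]
    exact sub_pos.2 (max_lt hl hT)
  obtain ⟨t, ht₁, ht₂⟩ :=
    ((ae_restrict_of_ae_restrict_of_subset (Ioo_subset_Ioo_left (le_max_right l 0)) hae).and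
      (ae_restrict_of_forall_mem measurableSet_Ioo fun t ht =>
        hsub (Ioo_subset_Ioo_left (le_max_left l 0) ht))).exists
  exact absurd ht₂ (not_lt.2 ht₁)

/-- **`sup_{0 ≤ t < T} ‖u(t)‖_{L³} = ∞` for the crux's class** (Escauriaza–Seregin–Šverák 2003,
Thms. 1.3–1.4, in the tree's continuation form `hasSmoothExtensionPast_of_eLpNorm_three_bounded_holds`):
a bounded critical norm on `[0, T)` would continue the solution smoothly past `T`, contradicting
maximality. [cite: EscauriazaSereginSverak2003, Thms. 1.3–1.4] -/
theorem iSup_eLpNorm_three_eq_top_of_isMaximalSmoothSolution (hν : 0 < ν) (hT : 0 < T)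
    (hmax : IsMaximalSmoothSolution ν 0 u p T) (hLH : IsLerayHopfOn T ν 0 (u 0) u)
    (hdec : HasRapidSpatialDecay (u 0)) :
    (⨆ t ∈ Ico 0 T, eLpNorm (u t) 3 volume) = ⊤ := by
  by_contra hne
  exact hmax.2 (hasSmoothExtensionPast_of_eLpNorm_three_bounded_holds ν T hν hT u p hmax.1 hLH hdec
    (lt_top_iff_ne_top.2 hne))

end Witness

/-- **Seregin's `L³` blow-up at the crux** (registered stub of stmt-NavierStokesRegularity-0727):
for every witness `(ν, T, u, p)` of `CertifiedBlowupAxisymBlowup` — a maximal Leray–Hopf classical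
solution of finite lifespan `T > 0`, viscosity `ν > 0`, from a rapidly decaying axisymmetric datum —
the critical norm `‖u(t)‖_{L³(ℝ³)}` tends to `∞` as `t ↑ T` (genuine limit; Seregin 2012, Thm. 1.1)
and in particular `sup_{0 ≤ t < T} ‖u(t)‖_{L³} = ∞` (Escauriaza–Seregin–Šverák 2003,
Thms. 1.3–1.4). [cite: Seregin2012, Comm. Math. Phys. 312 Thm. 1.1] -/
theorem tendsto_eLpNorm_three_of_isMaximalSmoothSolution : ∀ {ν T : ℝ} {u : ℝ → EuclideanSpace ℝ (Fin 3) → EuclideanSpace ℝ (Fin 3)} {p : ℝ → EuclideanSpace ℝ (Fin 3) → ℝ}, 0 < ν → 0 < T → IsMaximalSmoothSolution ν 0 u p T → IsLerayHopfOn T ν 0 (u 0) u → HasRapidSpatialDecay (u 0) → IsAxisymmetric (u 0) → Filter.Tendsto (fun t => eLpNorm (u t) 3 volume) (nhdsWithin T (Set.Iio T)) (nhds ⊤) ∧ (⨆ t ∈ Set.Ico 0 T, eLpNorm (u t) 3 volume) = ⊤ :=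
  fun hν hT hmax hLH hdec haxi =>
    ⟨tendsto_eLpNorm_three_nhdsLT_of_isMaximalSmoothSolution hν hT hmax hLH hdec haxi,
      iSup_eLpNorm_three_eq_top_of_isMaximalSmoothSolution hν hT hmax hLH hdec⟩

end Summit.NavierStokesRegularity.NavierStokesRegularity.Theorems.CertifiedBlowupAxisymBlowup.CompactAmplification

end
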